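import Mathlib.MeasureTheory.Constructions.BorelSpace.Metric
import Mathlib.MeasureTheory.Constructions.BorelSpace.Order

/-!
# LatticeQCDFlow / Scaling — FAT MEASURABLE PARTITIONS of a compact metric space at every scale

HONEST FRAMING: exact (Metropolis-corrected) sampling algorithms for lattice gauge theory; figures of merit are
autocorrelation/cost numbers at stated couplings and volumes; no continuum-physics claim.

Venture `LatticeQCDFlow` (cell pub-lqcd), topic `Scaling`, FANOUT row 29 (theory-2) — OUR WORK (THEORY-2.md §3.3
v2.9; the finite-resolution device behind `Scaling/MeanActionTransportSteps.lean`).  In any compact metric space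
`X` and at every scale `δ > 0`:
* `exists_separated_net_fin` — finitely many points pairwise MORE than `δ` apart and within `δ` of every point
  (a `δ`-separated family of maximal cardinality; the cardinality is bounded through a finite `δ/2`-net);
* `exists_fat_partition` — a finite MEASURABLE PARTITION `(c_i)` of `X` with `B̄(n_i, δ/2) ⊆ c_i ⊆ B̄(n_i, δ)`
  (the Voronoi cells of such a net, ties broken by index).
These replace density / Lebesgue-differentiation arguments on `G^E` by finite sums: a measure is compared with a
Gibbs weight cell by cell, each cell being sandwiched between two concentric balls of comparable radii, so that
two-sided small-ball estimates `a·r^κ ≤ Haar(B̄(g,r)) ≤ A·r^κ` control every cell mass from both sides.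
Elementary; nothing here is cited as a fact.  Reading: Mattila, *Geometry of Sets and Measures in Euclidean
Spaces* (1995) Ch. 2 (covering theorems), whose Vitali/Besicovitch machinery is precisely what is AVOIDED here.
-/

noncomputable section

namespace Summit.Ventures.LatticeQCDFlow.Theory2.Lattice

open MeasureTheory Metric Set

/-! ## §1. Fat measurable partitions of a compact metric space at every scale -/

section Partition

variable {X : Type*} [MetricSpace X] [CompactSpace X]

/-- **Maximal separated nets.**  In a compact metric space, for every `δ > 0` there are finitely many points,
pairwise MORE than `δ` apart, within `δ` of every point (a `δ`-separated family of maximal cardinality — the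
cardinality is bounded through a finite `δ/2`-net — is a `δ`-net by maximality). [folklore] -/
theorem exists_separated_net_fin {δ : ℝ} (hδ : 0 < δ) :
    ∃ (m : ℕ) (n : Fin m → X), (∀ i j, i ≠ j → δ < dist (n i) (n j)) ∧ ∀ x, ∃ i, dist x (n i) ≤ δ := by
  classical
  obtain ⟨t, -, htfin, hcover⟩ := finite_cover_balls_of_compact (isCompact_univ (X := X)) (half_pos hδ)
  let good : Finset X → Prop := fun P => ∀ g ∈ P, ∀ g' ∈ P, g ≠ g' → δ < dist g g'
  let Pk : ℕ → Prop := fun k => ∃ P, good P ∧ P.card = k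
  set B : ℕ := htfin.toFinset.card with hB
  have hcard : ∀ P, good P → P.card ≤ B := by
    intro P hP
    have hc : ∀ g : X, ∃ c ∈ htfin.toFinset, dist g c < δ / 2 := fun g => by
      have := hcover (mem_univ g)
      rw [mem_iUnion₂] at this
      obtain ⟨c, hc, hgc⟩ := this
      exact ⟨c, htfin.mem_toFinset.2 hc, mem_ball.1 hgc⟩
    choose f hf hf' using hc
    refine Finset.card_le_card_of_injOn f (fun g _ => hf g) fun a ha b hb hab => ?_
    by_contra hne
    have h1 := hP a ha b hb hne
    have h2 := hf' a
    have h3 := hf' b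
    rw [← hab] at h3
    have h4 := dist_triangle_right a b (f a)
    linarith
  have hP0 : Pk 0 := ⟨∅, by simp [good], rfl⟩
  obtain ⟨P₀, hgood, hcardP₀⟩ : Pk (Nat.findGreatest Pk B) := Nat.findGreatest_spec (Nat.zero_le B) hP0
  -- maximality ⟹ net
  have hnet : ∀ x, ∃ g ∈ P₀, dist x g ≤ δ := by
    intro x
    by_contra hcon
    push Not at hcon
    have hx : x ∉ P₀ := fun hx => by
      have := hcon x hx
      rw [dist_self] at this
      linarith
    have hgood' : good (insert x P₀) := by
      intro a ha b hb hab
      rw [Finset.mem_insert] at ha hb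
      rcases ha with rfl | ha
      · rcases hb with rfl | hb
        · exact absurd rfl hab
        · exact hcon b hb
      · rcases hb with rfl | hb
        · rw [dist_comm]; exact hcon a ha
        · exact hgood a ha b hb hab
    have hP1 : Pk (Nat.findGreatest Pk B + 1) :=
      ⟨insert x P₀, hgood', by rw [Finset.card_insert_of_notMem hx, hcardP₀]⟩
    have hle : Nat.findGreatest Pk B + 1 ≤ B := by
      have := hcard _ hgood'
      rwa [Finset.card_insert_of_notMem hx, hcardP₀] at this
    exact Nat.findGreatest_is_greatest (Nat.lt_succ_self _) hle hP1
  refine ⟨P₀.card, fun i => (P₀.equivFin.symm i : X), fun i j hij => ?_, fun x => ?_⟩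
  · refine hgood _ (P₀.equivFin.symm i).2 _ (P₀.equivFin.symm j).2 fun h => hij ?_
    exact P₀.equivFin.symm.injective (Subtype.ext h)
  · obtain ⟨g, hg, hxg⟩ := hnet x
    exact ⟨P₀.equivFin ⟨g, hg⟩, by simpa using hxg⟩

/-- **Fat measurable partitions at every scale.**  In a compact metric space, for every `δ > 0` there is a finite
partition into measurable cells `c_i` with `B̄(n_i, δ/2) ⊆ c_i ⊆ B̄(n_i, δ)`: the Voronoi cells (ties broken by the
index) of a maximal `δ`-separated net. [folklore] -/
theorem exists_fat_partition [MeasurableSpace X] [OpensMeasurableSpace X] {δ : ℝ} (hδ : 0 < δ) :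
    ∃ (m : ℕ) (n : Fin m → X) (c : Fin m → Set X),
      (∀ i, MeasurableSet (c i)) ∧ Pairwise (Function.onFun Disjoint c) ∧ (⋃ i, c i) = univ ∧
      (∀ i, c i ⊆ closedBall (n i) δ) ∧ ∀ i, closedBall (n i) (δ / 2) ⊆ c i := by
  classical
  obtain ⟨m, n, hsep, hnet⟩ := exists_separated_net_fin (X := X) hδ
  refine ⟨m, n,
    fun i => {x | (∀ j, dist x (n i) ≤ dist x (n j)) ∧ ∀ k, k < i → dist x (n i) < dist x (n k)},
    fun i => ?_, fun i i' hii' => ?_, ?_, fun i x hx => ?_, fun i x hx => ?_⟩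
  · -- measurability: finitely many closed / open conditions on continuous distance functions
    have hcont : ∀ j, Continuous fun x : X => dist x (n j) := fun j => continuous_id.dist continuous_const
    simp only [setOf_and, setOf_forall]
    refine (MeasurableSet.iInter fun j => measurableSet_le (hcont i).measurable (hcont j).measurable).inter
      (MeasurableSet.iInter fun k => MeasurableSet.iInter fun _ =>
        measurableSet_lt (hcont i).measurable (hcont k).measurable)
  · -- disjointness
    rw [Function.onFun, Set.disjoint_left]
    rintro x ⟨hxi, hxi'⟩ ⟨hxj, hxj'⟩
    rcases lt_or_gt_of_ne hii' with h | h
    · exact absurd (hxj' i h) (not_lt.2 (hxi i'))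
    · exact absurd (hxi' i' h) (not_lt.2 (hxj i))
  · -- cover: the least index among the distance minimisers
    refine eq_univ_of_forall fun x => ?_
    rw [mem_iUnion]
    have hne : (Finset.univ : Finset (Fin m)).Nonempty := by
      obtain ⟨i, -⟩ := hnet x
      exact ⟨i, Finset.mem_univ i⟩
    obtain ⟨i₀, -, hi₀⟩ := Finset.exists_min_image Finset.univ (fun j => dist x (n j)) hne
    set M : Finset (Fin m) := Finset.univ.filter fun j => ∀ j', dist x (n j) ≤ dist x (n j') with hM
    have hMne : M.Nonempty :=
      ⟨i₀, Finset.mem_filter.2 ⟨Finset.mem_univ _, fun j' => hi₀ j' (Finset.mem_univ _)⟩⟩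
    obtain ⟨-, hmin2⟩ := Finset.mem_filter.1 (Finset.min'_mem M hMne)
    refine ⟨M.min' hMne, hmin2, fun k hk => ?_⟩
    have hkM : k ∉ M := fun hkM => not_lt_of_ge (Finset.min'_le M k hkM) hk
    have hk' : ¬ ∀ j', dist x (n k) ≤ dist x (n j') := fun h =>
      hkM (Finset.mem_filter.2 ⟨Finset.mem_univ k, h⟩)
    push Not at hk'
    obtain ⟨j', hj'⟩ := hk'
    exact (hmin2 j').trans_lt hj'
  · -- `c i ⊆ B̄(n i, δ)`
    obtain ⟨j, hj⟩ := hnet x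
    exact mem_closedBall.2 ((hx.1 j).trans hj)
  · -- `B̄(n i, δ/2) ⊆ c i`
    rw [mem_closedBall] at hx
    have hlt : ∀ j, j ≠ i → dist x (n i) < dist x (n j) := fun j hji => by
      have h1 := hsep j i hji
      have h2 := dist_triangle (n j) x (n i)
      rw [dist_comm (n j) x] at h2
      linarith
    exact ⟨fun j => (eq_or_ne j i).elim (fun h => h ▸ le_rfl) fun h => (hlt j h).le, fun k hk => hlt k hk.ne⟩

end Partition

end Summit.Ventures.LatticeQCDFlow.Theory2.Lattice
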